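/-
Copyright (c) 2026 the pub-hodgecm-mathlib formalisation cell (harness21).  Prover seat hodgecm-mathlib-K2E3-p14 (g4), Track B «K2-LIT» ∕ h413
(`stmt-HodgeConjecture-24833`), line `K2_E3_EllipticInputs`, unit U12, §L road «U-iso-T» brick (G⁺-b)/(K4-c): STRUCTURAL LOCAL CONSTANCY OF THE
`K`-AVERAGES `A_Ω(X) = ∫_K Ω(det k, (k⁻¹Xk)₁₀) dκ` ON THE REGULAR SEMISIMPLE SET, UNIFORM IN THE WEIGHT `Ω`.  2026-09-04.
-/
import Summits.HodgeConjecture.HodgeConjecture.Theorems.K2E3LocalFieldSquaresHensel   -- ★ p857064 (K2E5-p10 (g4)): `exists_sq_add_mul_eq`, `isSquare_of_normAbs_sub_one_lt`, `isSquare_units_iff`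
import Literature.NumberTheory.Weil1964.GLnIntegerPointsVolume                        -- ★ `glInt`, `mem_glInt_iff_forall_mem_integer_and_normAbs_det_eq_one`
import Literature.NumberTheory.Automorphic.TateGaussSums                              -- ★ `TateDirect.extend_coe_mul` (`χ̃(u·x) = χ(u)·χ̃(x)`)
import Mathlib.LinearAlgebra.Matrix.Charpoly.Disc
import Mathlib.MeasureTheory.Group.Integral
import HarnessLib

/-!
# K2_E3 road (h413), §L brick (G⁺-b)/(K4-c) — structural local constancy of the `K`-averages, uniform in the weight

Cell `pub/hodgecm-mathlib` (D-0151), Track B, seat K2E3-p14 (g4) (E3 §L line; §L lead K2E3-p12 (g5); dealer K2E3-plan (g3); (G⁺-b) `K`-side, successor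
hand of K2E5-p10 (g4)).  `--supports stmt-HodgeConjecture-24833 --as helper`; THEOREMS ONLY (no definition ∕ instance ∕ notation ∕ named fact ∕ `sorry`);
never imports `Cruxes/…/Lines`.  COUNT-NEUTRAL.

For `K = GL₂(𝒪)`, a left-invariant measure `κ` on `K`, and a weight `Ω : F → F → E` with `Ω(d·u, v·s) = Ω(d, s)` whenever `u, v ∈ 𝒪ˣ` with `u·v` a
square (the invariance class of ★ (K3±) p857447 `integral_glInt_detEntryWeight_eq_cells`), the `K`-average `A_Ω(X) = ∫_K Ω(det k, (k⁻¹ X k)₁₀) dκ(k)` is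
LOCALLY CONSTANT near every regular semisimple `X₀ ∈ 𝔤𝔩₂(F)` (`disc χ_{X₀} ≠ 0`, `char F ≠ 2`), with a neighbourhood that does NOT depend on `Ω`
(**`eventually_forall_integral_glInt_detEntryWeight_eq`**); in particular, in the §L lead's frozen currency, the truncated twisted `K`-averages
`A n X = ∫_K χ̃(det k)·ω_n((k⁻¹Xk)₁₀) dκ` (`ω_n = 1_{(𝔭^{2n})ᶜ}·χ̃·‖·‖⁻¹`, `χ` quadratic) satisfy `∀ X₀, IsUnit (disc χ_{X₀}) → ∀ᶠ X in 𝓝 X₀, ∀ n, A n X = A n X₀`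
(**`twistedKAverage_locallyConstant`**) — the `hlc` binder of ★ (K5a) `exists_limitDensity_of_eventually_const` (`Fr_Z := lim_n A n`).
Proof: (i) `κ` left-invariant ⇒ `A_Ω(hTh⁻¹) = ∫ Ω(det h·det k, (k⁻¹Tk)₁₀) dκ` (`h ∈ K`); (ii) `(k⁻¹(u + vX₀)k)₁₀ = v·(k⁻¹X₀k)₁₀`; (iii) for `X` near `X₀`:
`X = hTh⁻¹`, `T = u + vX₀`, `v² = disc χ_X ∕ disc χ_{X₀}` (one-variable Hensel ★ `exists_sq_add_mul_eq`, `v → 1`), `u = (tr X − v·tr X₀)∕2`, `h = (det[w;wX₀])⁻¹·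
adj[w;wX]·[w;wT] → 1` (`w` a cyclic row vector of `X₀`; §1), so `h ∈ K`, `‖det h‖ = ‖v‖ = 1` and `det h · v ∈ 1 + 4𝔭` is a square (★ `isSquare_of_normAbs_sub_one_lt`).
[HarishChandra1999AdmissibleDistributions, §7] [LabesseLanglands1979, §2]

HONEST LABEL: HC_CM is proved only modulo the 7 printed citations (2 remaining named inputs: hLiu418 = stmt-HodgeConjecture-24832, h413 =
stmt-HodgeConjecture-24833) until rung 0 closes; count-neutral helper toward (LBU-2⁺)∕(G⁺-b), NOT ★.

## References
* [HarishChandra1999AdmissibleDistributions] Harish-Chandra (DeBacker–Sally), *Admissible Invariant Distributions on Reductive p-adic Groups* (1999), §7.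
* [LabesseLanglands1979] J.-P. Labesse, R. P. Langlands, *L-indistinguishability for SL(2)*, Canad. J. Math. 31 (1979), §2.
-/

set_option autoImplicit false
set_option linter.dupNamespace false   -- `Summit.HodgeConjecture.HodgeConjecture.…` (D-0017 nested layout; lakefile exemption for Summits)

noncomputable section

open MeasureTheory Measure Filter Topology Set
open scoped MatrixGroups NNReal ENNReal Pointwise
open ValuativeRel
open Literature.NumberTheory.Automorphic Literature.NumberTheory.Automorphic.LocalFieldHaar
open Literature.NumberTheory.GaloisRepresentations Literature.NumberTheory.GaloisRepresentations.IsNonarchimedeanLocalField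
open Summit.HodgeConjecture.HodgeConjecture.Cruxes.H413.K2E3LocalFieldSquaresHensel

namespace Summit.HodgeConjecture.HodgeConjecture.Cruxes.H413.K2E3GL2TwistedKAverageLocallyConstant

variable {F : Type*} [Field F] [ValuativeRel F] [TopologicalSpace F] [IsNonarchimedeanLocalField F]

section Algebra

/-! ## §1  Two-by-two algebra: the row pair `[w ; wY]`, Cayley–Hamilton, and the conjugator -/

variable {R : Type*} [CommRing R]

/-- **Cayley–Hamilton in the row pair**: `[w ; wY]·Y = [[0, 1], [−det Y, tr Y]]·[w ; wY]`. [folklore] -/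
theorem rowPair_mul_eq (w : Fin 2 → R) (Y : Matrix (Fin 2) (Fin 2) R) :
    (Matrix.of ![w, Matrix.vecMul w Y] : Matrix (Fin 2) (Fin 2) R) * Y = !![0, 1; -Y.det, Y.trace] * (Matrix.of ![w, Matrix.vecMul w Y] : Matrix (Fin 2) (Fin 2) R) := by
  ext i j
  fin_cases i <;> fin_cases j <;>
    simp [Matrix.mul_apply, Fin.sum_univ_two, Matrix.vecMul, dotProduct, Matrix.det_fin_two, Matrix.trace_fin_two] <;> ring

/-- **The adjugate intertwines**: `Y·adj[w ; wY] = adj[w ; wY]·[[0, 1], [−det Y, tr Y]]` (a polynomial identity, no invertibility needed). [folklore] -/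
theorem mul_adjugate_rowPair_eq (w : Fin 2 → R) (Y : Matrix (Fin 2) (Fin 2) R) :
    Y * ((Matrix.of ![w, Matrix.vecMul w Y] : Matrix (Fin 2) (Fin 2) R)).adjugate = ((Matrix.of ![w, Matrix.vecMul w Y] : Matrix (Fin 2) (Fin 2) R)).adjugate * !![0, 1; -Y.det, Y.trace] := by
  rw [Matrix.adjugate_fin_two]
  ext i j
  fin_cases i <;> fin_cases j <;>
    simp [Matrix.mul_apply, Fin.sum_univ_two, Matrix.vecMul, dotProduct, Matrix.det_fin_two, Matrix.trace_fin_two] <;> ring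

/-- **The conjugator**: if `tr T = tr X` and `det T = det X` then `h = adj[w ; wX]·[w ; wT]` satisfies `X·h = h·T`. [folklore] -/
theorem mul_conjugator_eq (w : Fin 2 → R) {X T : Matrix (Fin 2) (Fin 2) R} (htr : T.trace = X.trace) (hdet : T.det = X.det) :
    X * (((Matrix.of ![w, Matrix.vecMul w X] : Matrix (Fin 2) (Fin 2) R)).adjugate * (Matrix.of ![w, Matrix.vecMul w T] : Matrix (Fin 2) (Fin 2) R)) = ((Matrix.of ![w, Matrix.vecMul w X] : Matrix (Fin 2) (Fin 2) R)).adjugate * (Matrix.of ![w, Matrix.vecMul w T] : Matrix (Fin 2) (Fin 2) R) * T := by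
  rw [← Matrix.mul_assoc, mul_adjugate_rowPair_eq, Matrix.mul_assoc, ← htr, ← hdet, ← rowPair_mul_eq, Matrix.mul_assoc]

/-- `det [w ; wX₀] = X₀₀₁ w₀² + (X₀₁₁ − X₀₀₀) w₀ w₁ − X₀₁₀ w₁²`. [folklore] -/
theorem det_rowPair (w : Fin 2 → R) (X₀ : Matrix (Fin 2) (Fin 2) R) :
    (Matrix.of ![w, Matrix.vecMul w X₀] : Matrix (Fin 2) (Fin 2) R).det = X₀ 0 1 * w 0 ^ 2 + (X₀ 1 1 - X₀ 0 0) * w 0 * w 1 - X₀ 1 0 * w 1 ^ 2 := by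
  simp [Matrix.det_fin_two, Matrix.vecMul, dotProduct, Fin.sum_univ_two]; ring

/-- **A regular semisimple `X₀ ∈ 𝔤𝔩₂` has a cyclic row vector**: if `tr² − 4 det ≠ 0` then `det [w ; wX₀] ≠ 0` for some `w`. [folklore] -/
theorem exists_det_rowPair_ne_zero {K : Type*} [Field K] {X₀ : Matrix (Fin 2) (Fin 2) K} (hD : X₀.trace ^ 2 - 4 * X₀.det ≠ 0) :
    ∃ w : Fin 2 → K, (Matrix.of ![w, Matrix.vecMul w X₀] : Matrix (Fin 2) (Fin 2) K).det ≠ 0 := by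
  by_cases h01 : X₀ 0 1 ≠ 0
  · exact ⟨![1, 0], by rw [det_rowPair]; simpa using h01⟩
  by_cases h10 : X₀ 1 0 ≠ 0
  · exact ⟨![0, 1], by rw [det_rowPair]; simpa using h10⟩
  push Not at h01 h10
  have hne : X₀ 1 1 - X₀ 0 0 ≠ 0 := fun h => hD (by
    rw [Matrix.trace_fin_two, Matrix.det_fin_two, h01, zero_mul, sub_zero, show X₀ 1 1 = X₀ 0 0 from (sub_eq_zero.1 h)]; ring)
  exact ⟨![1, 1], by rw [det_rowPair, h01, h10]; simpa using hne⟩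

/-- `tr (u·1 + v·X₀) = 2u + v·tr X₀`. [folklore] -/
theorem trace_scalar_add_smul (u v : R) (X₀ : Matrix (Fin 2) (Fin 2) R) :
    (u • (1 : Matrix (Fin 2) (Fin 2) R) + v • X₀).trace = 2 * u + v * X₀.trace := by
  simp [Matrix.trace_fin_two]; ring

/-- `det (u·1 + v·X₀) = u² + u v·tr X₀ + v²·det X₀`. [folklore] -/
theorem det_scalar_add_smul (u v : R) (X₀ : Matrix (Fin 2) (Fin 2) R) :
    (u • (1 : Matrix (Fin 2) (Fin 2) R) + v • X₀).det = u ^ 2 + u * v * X₀.trace + v ^ 2 * X₀.det := by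
  simp [Matrix.det_fin_two, Matrix.trace_fin_two]; ring

/-- **The `(1,0)` entry of a conjugate of `u·1 + v·X₀` is `v` times that of the conjugate of `X₀`.** [folklore] -/
theorem conj_scalar_add_smul_apply_one_zero (k : GL (Fin 2) R) (u v : R) (X₀ : Matrix (Fin 2) (Fin 2) R) :
    ((((k⁻¹ : GL (Fin 2) R)) : Matrix (Fin 2) (Fin 2) R) * (u • (1 : Matrix (Fin 2) (Fin 2) R) + v • X₀) * ((k : GL (Fin 2) R) : Matrix (Fin 2) (Fin 2) R)) 1 0 =
      v * (((((k⁻¹ : GL (Fin 2) R)) : Matrix (Fin 2) (Fin 2) R) * X₀ * ((k : GL (Fin 2) R) : Matrix (Fin 2) (Fin 2) R)) 1 0) := by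
  have h1 : (((k⁻¹ : GL (Fin 2) R)) : Matrix (Fin 2) (Fin 2) R) * ((k : GL (Fin 2) R) : Matrix (Fin 2) (Fin 2) R) = 1 := Units.inv_mul k
  rw [Matrix.mul_add, Matrix.add_mul, Matrix.mul_smul, Matrix.smul_mul, Matrix.mul_one, h1, Matrix.mul_smul, Matrix.smul_mul,
    Matrix.add_apply, Matrix.smul_apply, Matrix.smul_apply, Matrix.one_apply_ne (by decide), smul_zero, zero_add, smul_eq_mul]

/-- **The scalar-plus-multiple with prescribed trace and determinant** (`char ≠ 2`): with `u = 2⁻¹(tr X − v·tr X₀)` and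
`v²·(tr² X₀ − 4 det X₀) = tr² X − 4 det X`, the matrix `T = u·1 + v·X₀` has `tr T = tr X` and `det T = det X`. [folklore] -/
theorem trace_det_scalar_add_smul_eq {K : Type*} [Field K] (h2 : (2 : K) ≠ 0) (X₀ X : Matrix (Fin 2) (Fin 2) K) {v : K}
    (hv : v ^ 2 * (X₀.trace ^ 2 - 4 * X₀.det) = X.trace ^ 2 - 4 * X.det) :
    ((2⁻¹ * (X.trace - v * X₀.trace)) • (1 : Matrix (Fin 2) (Fin 2) K) + v • X₀).trace = X.trace ∧
      ((2⁻¹ * (X.trace - v * X₀.trace)) • (1 : Matrix (Fin 2) (Fin 2) K) + v • X₀).det = X.det := by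
  rw [trace_scalar_add_smul, det_scalar_add_smul]
  constructor
  · rw [← mul_assoc, mul_inv_cancel₀ h2, one_mul, sub_add_cancel]
  · have h4 : (4 : K) ≠ 0 := by rw [show (4 : K) = 2 * 2 by norm_num]; exact mul_ne_zero h2 h2
    apply mul_left_cancel₀ h4
    have : (2 : K) * 2⁻¹ = 1 := mul_inv_cancel₀ h2
    linear_combination ((2 * 2⁻¹ + 1) * (X.trace - v * X₀.trace) ^ 2 + 2 * (X.trace - v * X₀.trace) * v * X₀.trace) * this - hv

/-- `(gk)⁻¹ (g T g⁻¹) (gk) = k⁻¹ T k`. [folklore] -/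
theorem conj_conj_eq (g k : GL (Fin 2) R) (T : Matrix (Fin 2) (Fin 2) R) :
    ((((g * k)⁻¹ : GL (Fin 2) R)) : Matrix (Fin 2) (Fin 2) R) *
        (((g : GL (Fin 2) R) : Matrix (Fin 2) (Fin 2) R) * T * (((g⁻¹ : GL (Fin 2) R)) : Matrix (Fin 2) (Fin 2) R)) *
        (((g * k : GL (Fin 2) R)) : Matrix (Fin 2) (Fin 2) R) =
      (((k⁻¹ : GL (Fin 2) R)) : Matrix (Fin 2) (Fin 2) R) * T * ((k : GL (Fin 2) R) : Matrix (Fin 2) (Fin 2) R) := by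
  rw [mul_inv_rev, Units.val_mul, Units.val_mul]
  simp only [Matrix.mul_assoc, Units.inv_mul_cancel_left]

end Algebra

section Structure

/-! ## §2  Local structure near a regular semisimple element: `X = g (u·1 + v·X₀) g⁻¹`, `g ∈ K`, `‖v‖ = 1`, `det g · v` a square -/

/-- **Square roots near `1`, quantitatively** (`char F ≠ 2`): if `‖z − 1‖ < ‖2‖²` then `z = v²` with `‖v − 1‖·‖2‖ = ‖z − 1‖`
(★ `exists_sq_add_mul_eq` with `a = 2`). [cite: Serre1973CourseArithmetic, Ch. II §3.3] -/
theorem exists_sq_eq_of_normAbs_sub_one_lt (h2 : (2 : F) ≠ 0) {z : F} (hz : normAbs F (z - 1) < normAbs F 2 ^ 2) :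
    ∃ v : F, v ^ 2 = z ∧ normAbs F (v - 1) * normAbs F 2 = normAbs F (z - 1) := by
  obtain ⟨η, hη, hηn⟩ := exists_sq_add_mul_eq h2 hz
  exact ⟨1 + η, by linear_combination hη, by rw [add_sub_cancel_left]; exact hηn⟩

/-- `‖t‖ < 1 ⇒ ‖1 + t‖ = 1` (ultrametric). [folklore] -/
theorem normAbs_one_add_eq_one {t : F} (ht : normAbs F t < 1) : normAbs F (1 + t) = 1 := by
  have h := normAbs_add_eq_of_lt (a := (1 : F)) (t := t) (by rwa [map_one])
  rwa [map_one] at h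

/-- `Y ↦ [w ; wY]` is continuous. [folklore] -/
theorem continuous_rowPair (w : Fin 2 → F) :
    Continuous fun Y : Matrix (Fin 2) (Fin 2) F => (Matrix.of ![w, Matrix.vecMul w Y] : Matrix (Fin 2) (Fin 2) F) := by
  haveI : IsTopologicalRing F := inferInstance
  refine continuous_matrix fun i j => ?_
  fin_cases i
  · simp only [Matrix.of_apply, Fin.zero_eta, Matrix.cons_val_zero]
    exact continuous_const
  · simp only [Matrix.of_apply, Fin.mk_one, Matrix.cons_val_one, Matrix.cons_val_fin_one]
    exact (continuous_apply j).comp (continuous_const.matrix_vecMul continuous_id)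

/-- **THE LOCAL STRUCTURE LEMMA.**  `char F ≠ 2`, `tr² X₀ − 4 det X₀ ≠ 0`.  For all `X` in a neighbourhood of `X₀` there are `g ∈ GL₂(𝒪)`
and `u, v ∈ F` with `v ≠ 0`, `‖v‖ = 1`, `det g · v` a square, and `X = g·(u·1 + v·X₀)·g⁻¹`.  (`v² = disc χ_X ∕ disc χ_{X₀}` by one-variable
Hensel, `u = (tr X − v·tr X₀)∕2`, `g = (det[w ; wX₀])⁻¹·adj[w ; wX]·[w ; wT]` with `w` a cyclic row vector of `X₀`.)
[cite: HarishChandra1999AdmissibleDistributions, §7] -/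
theorem eventually_exists_conj_scalar_add_smul (h2 : (2 : F) ≠ 0) (X₀ : Matrix (Fin 2) (Fin 2) F) (hD : X₀.trace ^ 2 - 4 * X₀.det ≠ 0) :
    ∀ᶠ X in 𝓝 X₀, ∃ (g : GL (Fin 2) F) (u v : F), g ∈ glInt 2 F ∧ v ≠ 0 ∧ normAbs F v = 1 ∧
      IsSquare (((g : GL (Fin 2) F) : Matrix (Fin 2) (Fin 2) F).det * v) ∧
      X = ((g : GL (Fin 2) F) : Matrix (Fin 2) (Fin 2) F) * (u • (1 : Matrix (Fin 2) (Fin 2) F) + v • X₀) *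
        (((g⁻¹ : GL (Fin 2) F)) : Matrix (Fin 2) (Fin 2) F) := by
  haveI : IsTopologicalRing F := inferInstance
  obtain ⟨w, hw⟩ := exists_det_rowPair_ne_zero hD
  -- abbreviations: the scalar family `Tf (X, v) = u·1 + v·X₀` and the normalised conjugator `hf (X, v)`
  obtain ⟨Tf, hTf⟩ : ∃ Tf : Matrix (Fin 2) (Fin 2) F × F → Matrix (Fin 2) (Fin 2) F,
      ∀ X v, Tf (X, v) = (2⁻¹ * (X.trace - v * X₀.trace)) • (1 : Matrix (Fin 2) (Fin 2) F) + v • X₀ :=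
    ⟨fun p => (2⁻¹ * (p.1.trace - p.2 * X₀.trace)) • (1 : Matrix (Fin 2) (Fin 2) F) + p.2 • X₀, fun _ _ => rfl⟩
  obtain ⟨hf, hhf⟩ : ∃ hf : Matrix (Fin 2) (Fin 2) F × F → Matrix (Fin 2) (Fin 2) F,
      ∀ X v, hf (X, v) = ((Matrix.of ![w, Matrix.vecMul w X₀] : Matrix (Fin 2) (Fin 2) F).det)⁻¹ •
        ((Matrix.of ![w, Matrix.vecMul w X] : Matrix (Fin 2) (Fin 2) F).adjugate *
          (Matrix.of ![w, Matrix.vecMul w (Tf (X, v))] : Matrix (Fin 2) (Fin 2) F)) :=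
    ⟨fun p => ((Matrix.of ![w, Matrix.vecMul w X₀] : Matrix (Fin 2) (Fin 2) F).det)⁻¹ •
        ((Matrix.of ![w, Matrix.vecMul w p.1] : Matrix (Fin 2) (Fin 2) F).adjugate *
          (Matrix.of ![w, Matrix.vecMul w (Tf p)] : Matrix (Fin 2) (Fin 2) F)), fun _ _ => rfl⟩
  -- continuity of `Tf` and `hf`
  have hTc : Continuous Tf := by
    have : Tf = fun p => (2⁻¹ * (p.1.trace - p.2 * X₀.trace)) • (1 : Matrix (Fin 2) (Fin 2) F) + p.2 • X₀ := funext fun p => hTf p.1 p.2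
    rw [this]
    exact ((continuous_const.mul (continuous_fst.matrix_trace.sub (continuous_snd.mul continuous_const))).smul continuous_const).add
      (continuous_snd.smul continuous_const)
  have hhc : Continuous hf := by
    have : hf = fun p => ((Matrix.of ![w, Matrix.vecMul w X₀] : Matrix (Fin 2) (Fin 2) F).det)⁻¹ •
        ((Matrix.of ![w, Matrix.vecMul w p.1] : Matrix (Fin 2) (Fin 2) F).adjugate *
          (Matrix.of ![w, Matrix.vecMul w (Tf p)] : Matrix (Fin 2) (Fin 2) F)) := funext fun p => hhf p.1 p.2
    rw [this]
    exact ((((continuous_rowPair w).comp continuous_fst).matrix_adjugate).matrix_mul ((continuous_rowPair w).comp hTc)).const_smul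
      (((Matrix.of ![w, Matrix.vecMul w X₀] : Matrix (Fin 2) (Fin 2) F).det)⁻¹)
  -- values at `(X₀, 1)`
  have hT1 : Tf (X₀, 1) = X₀ := by rw [hTf]; simp
  have hh1 : hf (X₀, 1) = 1 := by rw [hhf, hT1, Matrix.adjugate_mul, smul_smul, inv_mul_cancel₀ hw, one_smul]
  -- the good set is a neighbourhood of `(X₀, 1)`
  have h20 : (0 : ℝ≥0) < normAbs F 2 := pos_iff_ne_zero.2 ((map_ne_zero (normAbs F)).2 h2)
  have hG : ∀ᶠ p in 𝓝 ((X₀, 1) : Matrix (Fin 2) (Fin 2) F × F),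
      (∀ i j, hf p i j ∈ 𝒪[F]) ∧ normAbs F ((hf p).det - 1) < 1 ∧ normAbs F (p.2 - 1) < 1 ∧
        normAbs F ((hf p).det * p.2 - 1) < normAbs F 2 ^ 2 := by
    have hA : ∀ᶠ p in 𝓝 ((X₀, 1) : Matrix (Fin 2) (Fin 2) F × F), ∀ i j, hf p i j ∈ 𝒪[F] := by
      refine eventually_all.2 fun i => eventually_all.2 fun j => ?_
      refine (hhc.matrix_elem i j).continuousAt.eventually_mem (Valuation.isOpen_integer.mem_nhds ?_)
      rw [hh1, Matrix.one_apply]; split_ifs; exacts [one_mem _, zero_mem _]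
    have hBc : Continuous fun p : Matrix (Fin 2) (Fin 2) F × F => normAbs F ((hf p).det - 1) :=
      continuous_normAbs.comp (hhc.matrix_det.sub continuous_const)
    have hB : ∀ᶠ p in 𝓝 ((X₀, 1) : Matrix (Fin 2) (Fin 2) F × F), normAbs F ((hf p).det - 1) < 1 :=
      hBc.continuousAt.eventually_lt continuousAt_const
        (by show normAbs F ((hf (X₀, 1)).det - 1) < 1; rw [hh1, Matrix.det_one, sub_self, map_zero]; exact zero_lt_one)
    have hCc : Continuous fun p : Matrix (Fin 2) (Fin 2) F × F => normAbs F (p.2 - 1) :=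
      continuous_normAbs.comp (continuous_snd.sub continuous_const)
    have hC : ∀ᶠ p in 𝓝 ((X₀, 1) : Matrix (Fin 2) (Fin 2) F × F), normAbs F (p.2 - 1) < 1 :=
      hCc.continuousAt.eventually_lt continuousAt_const
        (by show normAbs F ((1 : F) - 1) < 1; rw [sub_self, map_zero]; exact zero_lt_one)
    have hDc : Continuous fun p : Matrix (Fin 2) (Fin 2) F × F => normAbs F ((hf p).det * p.2 - 1) :=
      continuous_normAbs.comp ((hhc.matrix_det.mul continuous_snd).sub continuous_const)
    have hD' : ∀ᶠ p in 𝓝 ((X₀, 1) : Matrix (Fin 2) (Fin 2) F × F), normAbs F ((hf p).det * p.2 - 1) < normAbs F 2 ^ 2 :=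
      hDc.continuousAt.eventually_lt continuousAt_const
        (by show normAbs F ((hf (X₀, 1)).det * 1 - 1) < normAbs F 2 ^ 2; rw [hh1, Matrix.det_one, one_mul, sub_self, map_zero]; exact pow_pos h20 2)
    exact hA.and (hB.and (hC.and hD'))
  -- split the product neighbourhood; a ball `1 + 𝔭ⁿ` inside the `v`-side
  rw [nhds_prod_eq] at hG
  obtain ⟨pa, hpa, pb, hpb, hG'⟩ := eventually_prod_iff.1 hG
  have hc1 : Continuous fun t : F => 1 + t := continuous_const.add continuous_id
  have ht : Tendsto (fun t : F => 1 + t) (𝓝 0) (𝓝 1) := by have := hc1.tendsto 0; rwa [add_zero] at this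
  obtain ⟨n, -, hn⟩ := hasBasis_nhds_zero_primePowBall.eventually_iff.1 (ht.eventually hpb)
  have hρ0 : (0 : ℝ≥0) < ((residueFieldCard F : ℝ≥0)⁻¹) ^ (n : ℤ) := zpow_pos inv_residueFieldCard_pos _
  -- the discriminant ratio `disc χ_X ∕ disc χ_{X₀}` tends to `1`
  have hzc : Continuous fun X : Matrix (Fin 2) (Fin 2) F => normAbs F ((X.trace ^ 2 - 4 * X.det) / (X₀.trace ^ 2 - 4 * X₀.det) - 1) :=
    continuous_normAbs.comp ((((continuous_id.matrix_trace.pow 2).sub (continuous_const.mul continuous_id.matrix_det)).div_const _).sub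
      continuous_const)
  have hz0 : normAbs F ((X₀.trace ^ 2 - 4 * X₀.det) / (X₀.trace ^ 2 - 4 * X₀.det) - 1) = 0 := by rw [div_self hD, sub_self, map_zero]
  have hz1 : ∀ᶠ X in 𝓝 X₀, normAbs F ((X.trace ^ 2 - 4 * X.det) / (X₀.trace ^ 2 - 4 * X₀.det) - 1) < normAbs F 2 ^ 2 :=
    hzc.continuousAt.eventually_lt continuousAt_const (by rw [hz0]; exact pow_pos h20 2)
  have hz2 : ∀ᶠ X in 𝓝 X₀, normAbs F ((X.trace ^ 2 - 4 * X.det) / (X₀.trace ^ 2 - 4 * X₀.det) - 1) <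
      ((residueFieldCard F : ℝ≥0)⁻¹) ^ (n : ℤ) * normAbs F 2 :=
    hzc.continuousAt.eventually_lt continuousAt_const (by rw [hz0]; exact mul_pos hρ0 h20)
  filter_upwards [hpa, hz1, hz2] with X hXa hX1 hX2
  -- the square root `v` of the discriminant ratio, `v ∈ 1 + 𝔭ⁿ`
  obtain ⟨v, hv2, hvn⟩ := exists_sq_eq_of_normAbs_sub_one_lt h2 hX1
  have hvball : v - 1 ∈ primePowBall F (n : ℤ) := by
    show normAbs F (v - 1) ≤ ((residueFieldCard F : ℝ≥0)⁻¹) ^ (n : ℤ)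
    have : normAbs F (v - 1) * normAbs F 2 < ((residueFieldCard F : ℝ≥0)⁻¹) ^ (n : ℤ) * normAbs F 2 := by rw [hvn]; exact hX2
    exact (lt_of_mul_lt_mul_right this h20.le).le
  have hv' : (1 : F) + (v - 1) = v := by ring
  have hgood := hG' hXa (hn hvball)
  rw [hv'] at hgood
  obtain ⟨hint, hdet1, hv1, hsq⟩ := hgood
  -- unpack the good conditions at `(X, v)`
  have hdetn : normAbs F (hf (X, v)).det = 1 := by have := normAbs_one_add_eq_one hdet1; rwa [add_sub_cancel] at this
  have hdet0 : (hf (X, v)).det ≠ 0 := fun h => by rw [h, map_zero] at hdetn; exact zero_ne_one hdetn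
  have hvn1 : normAbs F v = 1 := by have := normAbs_one_add_eq_one hv1; rwa [hv'] at this
  have hv0 : v ≠ 0 := fun h => by rw [h, map_zero] at hvn1; exact zero_ne_one hvn1
  refine ⟨Matrix.GeneralLinearGroup.mkOfDetNeZero _ hdet0, 2⁻¹ * (X.trace - v * X₀.trace), v, ?_, hv0, hvn1,
    isSquare_of_normAbs_sub_one_lt h2 hsq, ?_⟩
  · exact (Literature.NumberTheory.Weil1964.mem_glInt_iff_forall_mem_integer_and_normAbs_det_eq_one _).2 ⟨hint, hdetn⟩
  · -- `X·h = h·T` (§1), hence `X = h T h⁻¹`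
    have hrel : v ^ 2 * (X₀.trace ^ 2 - 4 * X₀.det) = X.trace ^ 2 - 4 * X.det := by
      rw [hv2, div_mul_cancel₀ _ hD]
    obtain ⟨htr, hdet⟩ := trace_det_scalar_add_smul_eq h2 X₀ X hrel
    have hTX : Tf (X, v) = (2⁻¹ * (X.trace - v * X₀.trace)) • (1 : Matrix (Fin 2) (Fin 2) F) + v • X₀ := hTf X v
    have hXh : X * hf (X, v) = hf (X, v) * Tf (X, v) := by
      rw [hhf, Matrix.mul_smul, Matrix.smul_mul, hTX]
      exact congrArg _ (mul_conjugator_eq w htr hdet)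
    have hmul : hf (X, v) * (((Matrix.GeneralLinearGroup.mkOfDetNeZero _ hdet0)⁻¹ : GL (Fin 2) F) : Matrix (Fin 2) (Fin 2) F) = 1 :=
      Units.mul_inv (Matrix.GeneralLinearGroup.mkOfDetNeZero _ hdet0)
    show X = hf (X, v) * _ * _
    rw [← hTX, ← hXh, Matrix.mul_assoc, hmul, Matrix.mul_one]

end Structure

section Main

variable [MeasurableSpace (GL (Fin 2) F)] [BorelSpace (GL (Fin 2) F)]

/-- **STRUCTURAL LOCAL CONSTANCY, UNIFORM IN THE WEIGHT.**  `char F ≠ 2`, `κ` a left-invariant measure on `K = GL₂(𝒪)`, `X₀ ∈ 𝔤𝔩₂(F)` with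
`disc χ_{X₀}` a unit.  Then for all `X` in a neighbourhood of `X₀` (independent of the weight), and every weight `Ω : F → F → E` with
`Ω(d·u, v·s) = Ω(d, s)` for `u, v ∈ 𝒪ˣ`, `u·v` a square:  `∫_K Ω(det k, (k⁻¹Xk)₁₀) dκ = ∫_K Ω(det k, (k⁻¹X₀k)₁₀) dκ`.
[cite: HarishChandra1999AdmissibleDistributions, §7] [cite: LabesseLanglands1979, §2] -/
theorem eventually_forall_integral_glInt_detEntryWeight_eq {E : Type*} [NormedAddCommGroup E] [NormedSpace ℝ E] (h2 : (2 : F) ≠ 0)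
    (κ : Measure ↥(glInt 2 F)) [κ.IsMulLeftInvariant] (X₀ : Matrix (Fin 2) (Fin 2) F) (hX₀ : IsUnit X₀.charpoly.discr) :
    ∀ᶠ X in 𝓝 X₀, ∀ Ω : F → F → E,
      (∀ (d s : F) (u v : Fˣ), normAbs F (u : F) = 1 → normAbs F (v : F) = 1 → IsSquare (u * v) → Ω (d * u) (v * s) = Ω d s) →
      ∫ k, Ω (((k : GL (Fin 2) F) : Matrix (Fin 2) (Fin 2) F)).det
          ((((((k : GL (Fin 2) F))⁻¹ : GL (Fin 2) F) : Matrix (Fin 2) (Fin 2) F) * X * ((k : GL (Fin 2) F) : Matrix (Fin 2) (Fin 2) F)) 1 0) ∂κ =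
      ∫ k, Ω (((k : GL (Fin 2) F) : Matrix (Fin 2) (Fin 2) F)).det
          ((((((k : GL (Fin 2) F))⁻¹ : GL (Fin 2) F) : Matrix (Fin 2) (Fin 2) F) * X₀ * ((k : GL (Fin 2) F) : Matrix (Fin 2) (Fin 2) F)) 1 0) ∂κ := by
  haveI : BorelSpace ↥(glInt 2 F) := Subtype.borelSpace _
  have hD : X₀.trace ^ 2 - 4 * X₀.det ≠ 0 := by rw [← Matrix.discr_fin_two]; exact hX₀.ne_zero
  filter_upwards [eventually_exists_conj_scalar_add_smul h2 X₀ hD] with X hX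
  obtain ⟨g, u, v, hg, hv0, hv1, hsq, rfl⟩ := hX
  intro Ω hΩ
  -- the substitution `k ↦ g k` (left-invariance of `κ`)
  refine ((integral_mul_left_eq_self (μ := κ)
    (fun k : ↥(glInt 2 F) => Ω (((k : GL (Fin 2) F) : Matrix (Fin 2) (Fin 2) F)).det
      ((((((k : GL (Fin 2) F))⁻¹ : GL (Fin 2) F) : Matrix (Fin 2) (Fin 2) F) *
        (((g : GL (Fin 2) F) : Matrix (Fin 2) (Fin 2) F) * (u • (1 : Matrix (Fin 2) (Fin 2) F) + v • X₀) *
          (((g⁻¹ : GL (Fin 2) F)) : Matrix (Fin 2) (Fin 2) F)) *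
        ((k : GL (Fin 2) F) : Matrix (Fin 2) (Fin 2) F)) 1 0)) ⟨g, hg⟩).symm).trans ?_
  refine integral_congr_ae (ae_of_all _ fun k => ?_)
  -- pointwise: `det (gk) = det g · det k`, `(gk)⁻¹ (gTg⁻¹) (gk) = k⁻¹ T k`, `(k⁻¹Tk)₁₀ = v·(k⁻¹X₀k)₁₀`, then the invariance of `Ω`
  have hcoe : (((⟨g, hg⟩ * k : ↥(glInt 2 F)) : GL (Fin 2) F)) = g * (k : GL (Fin 2) F) := rfl
  simp only [hcoe]
  rw [conj_conj_eq, conj_scalar_add_smul_apply_one_zero, Units.val_mul, Matrix.det_mul, mul_comm ((g : Matrix (Fin 2) (Fin 2) F)).det]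
  have hdetg : normAbs F ((Matrix.GeneralLinearGroup.det g : Fˣ) : F) = 1 := by
    rw [Matrix.GeneralLinearGroup.val_det_apply]
    exact ((Literature.NumberTheory.Weil1964.mem_glInt_iff_forall_mem_integer_and_normAbs_det_eq_one g).1 hg).2
  have hsq' : IsSquare (Matrix.GeneralLinearGroup.det g * Units.mk0 v hv0) := by
    rw [isSquare_units_iff, Units.val_mul, Matrix.GeneralLinearGroup.val_det_apply, Units.val_mk0]
    exact hsq
  have key := hΩ (((k : GL (Fin 2) F) : Matrix (Fin 2) (Fin 2) F)).det
    ((((((k : GL (Fin 2) F))⁻¹ : GL (Fin 2) F) : Matrix (Fin 2) (Fin 2) F) * X₀ * ((k : GL (Fin 2) F) : Matrix (Fin 2) (Fin 2) F)) 1 0)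
    (Matrix.GeneralLinearGroup.det g) (Units.mk0 v hv0) hdetg (by rw [Units.val_mk0]; exact hv1) hsq'
  rw [Matrix.GeneralLinearGroup.val_det_apply, Units.val_mk0] at key
  exact key

end Main

section Twisted

/-! ## §4  (K4-c) in the §L lead's frozen currency (K2E3-p12 (g5) 05:25:19Z): the truncated twisted `K`-averages `A n X` -/

variable [MeasurableSpace (GL (Fin 2) F)] [BorelSpace (GL (Fin 2) F)]

omit [MeasurableSpace (GL (Fin 2) F)] [BorelSpace (GL (Fin 2) F)] in
/-- **The truncated twisted weight is in the invariance class of ★ (K3±).**  For a quadratic character `χ` (`χ² = 1`), `χ̃ = Function.extend (↑) χ 0`,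
`ω_n = 1_{(𝔭^{2n})ᶜ}·χ̃·‖·‖⁻¹`, units `u, v ∈ 𝒪ˣ` with `u·v` a square, and all `d, s`:  `χ̃(d·u)·ω_n(v·s) = χ̃(d)·ω_n(s)`. [cite: LabesseLanglands1979, §2] -/
theorem twistedWeight_mul_unit_eq (χ : QuasiChar F) (hχ2 : ∀ u, χ u * χ u = 1) (n : ℕ) (d s : F) (u v : Fˣ)
    (hv : normAbs F (v : F) = 1) (huv : IsSquare (u * v)) :
    Function.extend ((↑) : Fˣ → F) (fun u => ((χ u : ℂˣ) : ℂ)) 0 (d * u) *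
        (primePowBall F (2 * (n : ℤ)))ᶜ.indicator
          (fun y => Function.extend ((↑) : Fˣ → F) (fun u => ((χ u : ℂˣ) : ℂ)) 0 y * ((((normAbs F y)⁻¹ : ℝ≥0) : ℝ) : ℂ)) (v * s) =
      Function.extend ((↑) : Fˣ → F) (fun u => ((χ u : ℂˣ) : ℂ)) 0 d *
        (primePowBall F (2 * (n : ℤ)))ᶜ.indicator
          (fun y => Function.extend ((↑) : Fˣ → F) (fun u => ((χ u : ℂˣ) : ℂ)) 0 y * ((((normAbs F y)⁻¹ : ℝ≥0) : ℝ) : ℂ)) s := by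
  -- `χ(u)·χ(v) = χ(uv) = χ(r)² = 1`
  have h1 : ((χ u : ℂˣ) : ℂ) * ((χ v : ℂˣ) : ℂ) = 1 := by
    obtain ⟨r, hr⟩ := huv
    rw [← Units.val_mul, ← map_mul, hr, map_mul, hχ2, Units.val_one]
  have hvs : normAbs F ((v : F) * s) = normAbs F s := by rw [map_mul, hv, one_mul]
  have hdu : Function.extend ((↑) : Fˣ → F) (fun u => ((χ u : ℂˣ) : ℂ)) 0 (d * u) =
      ((χ u : ℂˣ) : ℂ) * Function.extend ((↑) : Fˣ → F) (fun u => ((χ u : ℂˣ) : ℂ)) 0 d := by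
    rw [mul_comm d, TateDirect.extend_coe_mul]
  by_cases hs : s ∈ (primePowBall F (2 * (n : ℤ)))ᶜ
  · have hs' : (v : F) * s ∈ (primePowBall F (2 * (n : ℤ)))ᶜ := by
      intro h; apply hs
      show normAbs F s ≤ _
      rw [← hvs]; exact h
    rw [indicator_of_mem hs, indicator_of_mem hs', hdu, TateDirect.extend_coe_mul, hvs]
    linear_combination Function.extend ((↑) : Fˣ → F) (fun u => ((χ u : ℂˣ) : ℂ)) 0 d *
      (Function.extend ((↑) : Fˣ → F) (fun u => ((χ u : ℂˣ) : ℂ)) 0 s * ((((normAbs F s)⁻¹ : ℝ≥0) : ℝ) : ℂ)) * h1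
  · have hs' : (v : F) * s ∉ (primePowBall F (2 * (n : ℤ)))ᶜ := by
      intro h; apply h
      show normAbs F ((v : F) * s) ≤ _
      rw [hvs]; exact not_not.1 (fun h' => hs h')
    rw [indicator_of_notMem hs, indicator_of_notMem hs', mul_zero, mul_zero]

/-- **(K4-c) «STRUCTURAL LOCAL CONSTANCY, UNIFORM IN n» IN THE FROZEN CURRENCY** (§L lead K2E3-p12 (g5) 05:25:19Z; the `hlc` binder of ★ (K5a)
`K2E3GL2RegularSetLimitDensity.exists_limitDensity_of_eventually_const`).  For `char F = 0`, a quadratic character `χ` of `Fˣ` (`χ² = 1`), `κ` left-invariant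
on `K = GL₂(𝒪)`, and the truncated twisted `K`-averages
`A n X = ∫_K χ̃(det k) · ω_n((k⁻¹Xk)₁₀) dκ`, `ω_n = 1_{(𝔭^{2n})ᶜ}·χ̃·‖·‖⁻¹`:  `∀ X₀, IsUnit (disc χ_{X₀}) → ∀ᶠ X in 𝓝 X₀, ∀ n, A n X = A n X₀`.
[cite: HarishChandra1999AdmissibleDistributions, §7] [cite: LabesseLanglands1979, §2] -/
theorem twistedKAverage_locallyConstant [CharZero F] (χ : QuasiChar F) (hχ2 : ∀ u, χ u * χ u = 1) (κ : Measure ↥(glInt 2 F))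
    [κ.IsMulLeftInvariant] :
    ∀ X₀ : Matrix (Fin 2) (Fin 2) F, IsUnit X₀.charpoly.discr → ∀ᶠ X in 𝓝 X₀, ∀ n : ℕ,
      ∫ k : ↥(glInt 2 F), Function.extend ((↑) : Fˣ → F) (fun u => ((χ u : ℂˣ) : ℂ)) 0 (((k : GL (Fin 2) F) : Matrix (Fin 2) (Fin 2) F)).det *
          (primePowBall F (2 * (n : ℤ)))ᶜ.indicator
            (fun y => Function.extend ((↑) : Fˣ → F) (fun u => ((χ u : ℂˣ) : ℂ)) 0 y * ((((normAbs F y)⁻¹ : ℝ≥0) : ℝ) : ℂ))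
            ((((((k : GL (Fin 2) F))⁻¹ : GL (Fin 2) F) : Matrix (Fin 2) (Fin 2) F) * X * ((k : GL (Fin 2) F) : Matrix (Fin 2) (Fin 2) F)) 1 0) ∂κ =
      ∫ k : ↥(glInt 2 F), Function.extend ((↑) : Fˣ → F) (fun u => ((χ u : ℂˣ) : ℂ)) 0 (((k : GL (Fin 2) F) : Matrix (Fin 2) (Fin 2) F)).det *
          (primePowBall F (2 * (n : ℤ)))ᶜ.indicator
            (fun y => Function.extend ((↑) : Fˣ → F) (fun u => ((χ u : ℂˣ) : ℂ)) 0 y * ((((normAbs F y)⁻¹ : ℝ≥0) : ℝ) : ℂ))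
            ((((((k : GL (Fin 2) F))⁻¹ : GL (Fin 2) F) : Matrix (Fin 2) (Fin 2) F) * X₀ * ((k : GL (Fin 2) F) : Matrix (Fin 2) (Fin 2) F)) 1 0) ∂κ :=
  fun X₀ hX₀ => (eventually_forall_integral_glInt_detEntryWeight_eq (E := ℂ) two_ne_zero κ X₀ hX₀).mono fun _ hX n =>
    hX (fun d s => Function.extend ((↑) : Fˣ → F) (fun u => ((χ u : ℂˣ) : ℂ)) 0 d *
        (primePowBall F (2 * (n : ℤ)))ᶜ.indicator
          (fun y => Function.extend ((↑) : Fˣ → F) (fun u => ((χ u : ℂˣ) : ℂ)) 0 y * ((((normAbs F y)⁻¹ : ℝ≥0) : ℝ) : ℂ)) s)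
      (fun d s u v _ hv huv => twistedWeight_mul_unit_eq χ hχ2 n d s u v hv huv)

end Twisted

end Summit.HodgeConjecture.HodgeConjecture.Cruxes.H413.K2E3GL2TwistedKAverageLocallyConstant

end
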